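import Mathlib
import HarnessLib

/-!
# Prop. 7 on T³ — lane II (B7-BUDGET, member form): the per-patch bookkeeping with the residual row AS LANDED, and the currency table

Route `UnitScaleTilt`, crux `MinimiserStabilityRegPr` (stmt-QuantumFields-19200), E′ growth side, lane II «divergence recovery at the curved regular member».
Companion of ✓`UnitScaleTiltProp7DivRecoveryAssemblyBudget` (`patch_budget`, whose residual row was the PLANNED shape `ρ ≤ CF·R²·(Cu + e²Φ + K)` with a
window).  The residual row actually typed for the member (w4-19200 g11, `Prop7BoxLocalResidualMember.boxLocalResidual_member`, conjunct (h4)) has the shape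
`ρ ≤ CF·R²·Cu + CF′·R⁴e²·N` — no feedback through `K`, the mass of `y` instead of `‖φ‖²`.  §1 `patch_budget_v2` redoes the one-patch bookkeeping with that
row (outputs in the SAME shapes as `patch_budget`, so ✓`Prop7DivRecoveryPatchesToRows.hRows_of_core_and_patches`'s `hPatch` rows are fed unchanged).
§2 is the CURRENCY TABLE of the [I-9] knit as generic real lemmas: the chart bricks speak in `(R_f, η, ℓ, α, d)` (`R_f ≤ 4R₀ℓ` the chart radius in lattice
units, `η·ℓ = 1`, `α ≤ A·e·η²`, `d = 3`), the budget in `(R₀ = L^s, e)`; the lemmas convert (B8-member)'s Poincaré and source rows, the residual row, the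
interior `H¹` row and the two plaquette windows.

HONEST SCOPE.  Elementary real inequalities; every row is a hypothesis; nothing of (REC)∕hN06∕the crux is proved here; YM₃ on T³ is rung R3 —
NOT d = 4, NOT infinite volume, NOT a mass gap, NOT Clay.
[cite: Balaban1985BackgroundPropagators, (3.19)-(3.26) pp.393-395, (3.100) p.413]
-/

noncomputable section

namespace Summit.QuantumFields.YangMills.Theorems.Prop7DivRecoveryAssemblyBudgetW4

/-! ## §1 One patch, with the residual row as landed -/

/-- ★★ **(B7-BUDGET) ONE PATCH, MEMBER FORM.**  As ✓`patch_budget` but with the residual row `h4 : ρ ≤ CF·R²·Cu + CF′·R⁴·e²·N` (no `K` feedback, no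
window); conclusions in the currencies `(As, Cu, R⁻²N, eN)` with the displayed coefficients (`R ≥ 1`, `0 ≤ e ≤ 1`). [folklore] -/
theorem patch_budget_v2 {N Cu As Gφ Φ ρ K L M Hρ HM Φt Nt Gc R e CΦ C8 CF CF' Cζ CM CH CP C9 C9' B BC BK Ct CW : ℝ}
    (hN : 0 ≤ N) (hCu : 0 ≤ Cu) (hρ0 : 0 ≤ ρ) (hΦ0 : 0 ≤ Φ)
    (hR : 1 ≤ R) (he0 : 0 ≤ e) (he1 : e ≤ 1)
    (hCΦ : 0 ≤ CΦ) (hC8 : 0 ≤ C8) (hCF : 0 ≤ CF) (hCF' : 0 ≤ CF') (hCζ : 0 ≤ Cζ) (hCM : 0 ≤ CM) (hCH : 0 ≤ CH) (hCP : 0 ≤ CP)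
    (hC9 : 0 ≤ C9) (hC9' : 0 ≤ C9') (hB : 0 ≤ B) (hBK : 0 ≤ BK) (hCt : 0 ≤ Ct) (hCW : 0 ≤ CW)
    (h1 : Gφ ≤ N) (h2 : Φ ≤ CΦ * R ^ 2 * Gφ) (h3 : K ≤ C8 * R ^ 2 * e ^ 2 * ρ) (h4 : ρ ≤ CF * R ^ 2 * Cu + CF' * R ^ 4 * e ^ 2 * N)
    (h5 : L ≤ Cζ * (R⁻¹ ^ 2 * N + R⁻¹ ^ 4 * Φ)) (h6 : M ≤ CM * R⁻¹ ^ 2 * Φt) (h7 : Φt ≤ CP * (Gφ + e ^ 2 * Φ) + Nt)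
    (h8 : Nt ≤ C9 * R ^ 2 * Gc + C9' * R ^ 4 * e ^ 2 * Φ) (h9 : Gc ≤ 4 * As + B * ρ + BC * Cu + BK * K + Ct * e ^ 2 * Φ)
    (h10 : Hρ ≤ CW * (Cu + e ^ 2 * Φ + K + R⁻¹ ^ 2 * ρ)) (h11 : HM ≤ CH * (R⁻¹ ^ 2 * Gφ + R⁻¹ ^ 4 * Φ)) :
    Φ ≤ CΦ * R ^ 2 * N ∧
    ρ ≤ CF * R ^ 2 * Cu + CF' * R ^ 4 * e * N ∧
    K ≤ C8 * CF * R ^ 4 * Cu + C8 * CF' * R ^ 6 * e * N ∧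
    L ≤ Cζ * (1 + CΦ) * R⁻¹ ^ 2 * N ∧
    M ≤ 4 * CM * C9 * As + CM * C9 * ((B + BK * C8 * R ^ 2) * CF * R ^ 2 + BC) * Cu
        + (CM * CP * R⁻¹ ^ 2
            + (CM * CP * CΦ + CM * C9 * Ct * CΦ * R ^ 2 + CM * C9' * CΦ * R ^ 4
                + CM * C9 * (B + BK * C8 * R ^ 2) * CF' * R ^ 4) * e) * N ∧
    Hρ ≤ CW * (1 + CF + C8 * CF * R ^ 4) * Cu + CW * (CΦ * R ^ 2 + CF' * R ^ 2 + C8 * CF' * R ^ 6) * e * N ∧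
    HM ≤ CH * (1 + CΦ) * R⁻¹ ^ 2 * N := by
  have hR0 : 0 < R := by linarith
  have hRi : R⁻¹ * R = 1 := inv_mul_cancel₀ hR0.ne'
  have he2 : e ^ 2 ≤ e := by rw [pow_two]; exact mul_le_of_le_one_left he0 he1
  have he21 : e ^ 2 ≤ 1 := he2.trans he1
  have hRR2 : R⁻¹ ^ 2 * R ^ 2 = 1 := by rw [← mul_pow, hRi, one_pow]
  have hRR4 : R⁻¹ ^ 2 * R ^ 4 = R ^ 2 := by
    calc R⁻¹ ^ 2 * R ^ 4 = (R⁻¹ ^ 2 * R ^ 2) * R ^ 2 := by ring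
      _ = R ^ 2 := by rw [hRR2, one_mul]
  have hRR6 : R⁻¹ ^ 2 * R ^ 6 = R ^ 4 := by
    calc R⁻¹ ^ 2 * R ^ 6 = (R⁻¹ ^ 2 * R ^ 2) * R ^ 4 := by ring
      _ = R ^ 4 := by rw [hRR2, one_mul]
  have hR4Φ : R⁻¹ ^ 4 * (CΦ * R ^ 2 * N) = R⁻¹ ^ 2 * (CΦ * N) := by
    calc R⁻¹ ^ 4 * (CΦ * R ^ 2 * N) = (R⁻¹ * R) ^ 2 * (R⁻¹ ^ 2 * (CΦ * N)) := by ring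
      _ = R⁻¹ ^ 2 * (CΦ * N) := by rw [hRi, one_pow, one_mul]
  -- (1) Φ
  have hΦ : Φ ≤ CΦ * R ^ 2 * N := h2.trans (mul_le_mul_of_nonneg_left h1 (by positivity))
  have heΦ : e ^ 2 * Φ ≤ e * (CΦ * R ^ 2 * N) := mul_le_mul he2 hΦ hΦ0 he0
  -- (2) ρ
  have hρ : ρ ≤ CF * R ^ 2 * Cu + CF' * R ^ 4 * e * N := by
    have h' : CF' * R ^ 4 * e ^ 2 * N ≤ CF' * R ^ 4 * e * N := by
      calc CF' * R ^ 4 * e ^ 2 * N = CF' * R ^ 4 * (e ^ 2 * N) := by ring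
        _ ≤ CF' * R ^ 4 * (e * N) := mul_le_mul_of_nonneg_left (mul_le_mul_of_nonneg_right he2 hN) (by positivity)
        _ = CF' * R ^ 4 * e * N := by ring
    linarith
  -- (3) K
  have hK : K ≤ C8 * CF * R ^ 4 * Cu + C8 * CF' * R ^ 6 * e * N := by
    have hKe : K ≤ C8 * R ^ 2 * e ^ 2 * (CF * R ^ 2 * Cu + CF' * R ^ 4 * e * N) :=
      h3.trans (mul_le_mul_of_nonneg_left hρ (by positivity))
    have he2Cu : e ^ 2 * Cu ≤ Cu := mul_le_of_le_one_left hCu he21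
    have heeN : e ^ 2 * (e * N) ≤ e * N := mul_le_of_le_one_left (mul_nonneg he0 hN) he21
    have hA : C8 * R ^ 2 * e ^ 2 * (CF * R ^ 2 * Cu) ≤ C8 * CF * R ^ 4 * Cu := by
      calc C8 * R ^ 2 * e ^ 2 * (CF * R ^ 2 * Cu) = C8 * CF * R ^ 4 * (e ^ 2 * Cu) := by ring
        _ ≤ C8 * CF * R ^ 4 * Cu := mul_le_mul_of_nonneg_left he2Cu (by positivity)
    have hB' : C8 * R ^ 2 * e ^ 2 * (CF' * R ^ 4 * e * N) ≤ C8 * CF' * R ^ 6 * e * N := by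
      calc C8 * R ^ 2 * e ^ 2 * (CF' * R ^ 4 * e * N) = C8 * CF' * R ^ 6 * (e ^ 2 * (e * N)) := by ring
        _ ≤ C8 * CF' * R ^ 6 * (e * N) := mul_le_mul_of_nonneg_left heeN (by positivity)
        _ = C8 * CF' * R ^ 6 * e * N := by ring
    have hsplit : C8 * R ^ 2 * e ^ 2 * (CF * R ^ 2 * Cu + CF' * R ^ 4 * e * N)
        = C8 * R ^ 2 * e ^ 2 * (CF * R ^ 2 * Cu) + C8 * R ^ 2 * e ^ 2 * (CF' * R ^ 4 * e * N) := by ring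
    rw [hsplit] at hKe
    linarith
  -- (4) L
  have hL : L ≤ Cζ * (1 + CΦ) * R⁻¹ ^ 2 * N := by
    have hΦ'' : R⁻¹ ^ 4 * Φ ≤ R⁻¹ ^ 2 * (CΦ * N) := by
      calc R⁻¹ ^ 4 * Φ ≤ R⁻¹ ^ 4 * (CΦ * R ^ 2 * N) := mul_le_mul_of_nonneg_left hΦ (by positivity)
        _ = R⁻¹ ^ 2 * (CΦ * N) := hR4Φ
    calc L ≤ Cζ * (R⁻¹ ^ 2 * N + R⁻¹ ^ 4 * Φ) := h5
      _ ≤ Cζ * (R⁻¹ ^ 2 * N + R⁻¹ ^ 2 * (CΦ * N)) := by apply mul_le_mul_of_nonneg_left _ hCζ; linarith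
      _ = Cζ * (1 + CΦ) * R⁻¹ ^ 2 * N := by ring
  -- (5) M
  have hM : M ≤ 4 * CM * C9 * As + CM * C9 * ((B + BK * C8 * R ^ 2) * CF * R ^ 2 + BC) * Cu
      + (CM * CP * R⁻¹ ^ 2
          + (CM * CP * CΦ + CM * C9 * Ct * CΦ * R ^ 2 + CM * C9' * CΦ * R ^ 4
              + CM * C9 * (B + BK * C8 * R ^ 2) * CF' * R ^ 4) * e) * N := by
    have hKρ : K ≤ C8 * R ^ 2 * ρ := by
      calc K ≤ C8 * R ^ 2 * e ^ 2 * ρ := h3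
        _ = C8 * R ^ 2 * (e ^ 2 * ρ) := by ring
        _ ≤ C8 * R ^ 2 * ρ := mul_le_mul_of_nonneg_left (mul_le_of_le_one_left hρ0 he21) (by positivity)
    have hGc : Gc ≤ 4 * As + (B + BK * C8 * R ^ 2) * ρ + BC * Cu + Ct * e ^ 2 * Φ := by
      have := mul_le_mul_of_nonneg_left hKρ hBK
      have hid' : (B + BK * C8 * R ^ 2) * ρ = B * ρ + BK * (C8 * R ^ 2 * ρ) := by ring
      rw [hid']
      linarith
    set B2 : ℝ := B + BK * C8 * R ^ 2 with hB2
    have hB20 : 0 ≤ B2 := by rw [hB2]; positivity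
    have hGc' : Gc ≤ 4 * As + B2 * CF * R ^ 2 * Cu + B2 * CF' * R ^ 4 * e * N + BC * Cu + Ct * CΦ * R ^ 2 * e * N := by
      have hρ' := mul_le_mul_of_nonneg_left hρ hB20
      have hΦ' : Ct * e ^ 2 * Φ ≤ Ct * CΦ * R ^ 2 * e * N := by
        calc Ct * e ^ 2 * Φ = Ct * (e ^ 2 * Φ) := by ring
          _ ≤ Ct * (e * (CΦ * R ^ 2 * N)) := mul_le_mul_of_nonneg_left heΦ hCt
          _ = Ct * CΦ * R ^ 2 * e * N := by ring
      linarith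
    have hNt : Nt ≤ C9 * R ^ 2 * (4 * As + B2 * CF * R ^ 2 * Cu + B2 * CF' * R ^ 4 * e * N + BC * Cu + Ct * CΦ * R ^ 2 * e * N)
        + C9' * CΦ * R ^ 6 * e * N := by
      have hA := mul_le_mul_of_nonneg_left hGc' (show 0 ≤ C9 * R ^ 2 by positivity)
      have hΦ' : C9' * R ^ 4 * e ^ 2 * Φ ≤ C9' * CΦ * R ^ 6 * e * N := by
        calc C9' * R ^ 4 * e ^ 2 * Φ = C9' * R ^ 4 * (e ^ 2 * Φ) := by ring
          _ ≤ C9' * R ^ 4 * (e * (CΦ * R ^ 2 * N)) := mul_le_mul_of_nonneg_left heΦ (by positivity)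
          _ = C9' * CΦ * R ^ 6 * e * N := by ring
      linarith
    have hΦt : Φt ≤ CP * N + CP * CΦ * R ^ 2 * e * N + Nt := by
      have hΦ' : e ^ 2 * Φ ≤ CΦ * R ^ 2 * e * N := by linarith [heΦ]
      have := mul_le_mul_of_nonneg_left (add_le_add h1 hΦ') hCP
      linarith
    have hstep : M ≤ CM * R⁻¹ ^ 2 * (CP * N + CP * CΦ * R ^ 2 * e * N
        + (C9 * R ^ 2 * (4 * As + B2 * CF * R ^ 2 * Cu + B2 * CF' * R ^ 4 * e * N + BC * Cu + Ct * CΦ * R ^ 2 * e * N)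
          + C9' * CΦ * R ^ 6 * e * N)) := by
      calc M ≤ CM * R⁻¹ ^ 2 * Φt := h6
        _ ≤ _ := by apply mul_le_mul_of_nonneg_left _ (by positivity); linarith
    have hexp : CM * R⁻¹ ^ 2 * (CP * N + CP * CΦ * R ^ 2 * e * N
        + (C9 * R ^ 2 * (4 * As + B2 * CF * R ^ 2 * Cu + B2 * CF' * R ^ 4 * e * N + BC * Cu + Ct * CΦ * R ^ 2 * e * N)
          + C9' * CΦ * R ^ 6 * e * N))
        = CM * CP * R⁻¹ ^ 2 * N + CM * CP * CΦ * (R⁻¹ ^ 2 * R ^ 2) * e * N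
          + 4 * CM * C9 * (R⁻¹ ^ 2 * R ^ 2) * As + CM * C9 * B2 * CF * (R⁻¹ ^ 2 * R ^ 4) * Cu
          + CM * C9 * B2 * CF' * (R⁻¹ ^ 2 * R ^ 6) * e * N + CM * C9 * BC * (R⁻¹ ^ 2 * R ^ 2) * Cu
          + CM * C9 * Ct * CΦ * (R⁻¹ ^ 2 * R ^ 4) * e * N + CM * C9' * CΦ * (R⁻¹ ^ 2 * R ^ 6) * e * N := by ring
    rw [hexp, hRR2, hRR4, hRR6] at hstep
    have hid : CM * CP * R⁻¹ ^ 2 * N + CM * CP * CΦ * 1 * e * N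
          + 4 * CM * C9 * 1 * As + CM * C9 * B2 * CF * R ^ 2 * Cu
          + CM * C9 * B2 * CF' * R ^ 4 * e * N + CM * C9 * BC * 1 * Cu
          + CM * C9 * Ct * CΦ * R ^ 2 * e * N + CM * C9' * CΦ * R ^ 4 * e * N
        = 4 * CM * C9 * As + CM * C9 * (B2 * CF * R ^ 2 + BC) * Cu
          + (CM * CP * R⁻¹ ^ 2 + (CM * CP * CΦ + CM * C9 * Ct * CΦ * R ^ 2 + CM * C9' * CΦ * R ^ 4
              + CM * C9 * B2 * CF' * R ^ 4) * e) * N := by ring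
    rw [hid] at hstep
    rw [hB2] at hstep
    exact hstep
  -- (6) Hρ
  have hHρ : Hρ ≤ CW * (1 + CF + C8 * CF * R ^ 4) * Cu + CW * (CΦ * R ^ 2 + CF' * R ^ 2 + C8 * CF' * R ^ 6) * e * N := by
    have hρ' : R⁻¹ ^ 2 * ρ ≤ CF * Cu + CF' * R ^ 2 * e * N := by
      calc R⁻¹ ^ 2 * ρ ≤ R⁻¹ ^ 2 * (CF * R ^ 2 * Cu + CF' * R ^ 4 * e * N) := mul_le_mul_of_nonneg_left hρ (by positivity)
        _ = CF * (R⁻¹ ^ 2 * R ^ 2) * Cu + CF' * (R⁻¹ ^ 2 * R ^ 4) * e * N := by ring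
        _ = CF * Cu + CF' * R ^ 2 * e * N := by rw [hRR2, hRR4, mul_one]
    have hsum : Cu + e ^ 2 * Φ + K + R⁻¹ ^ 2 * ρ ≤ (1 + CF + C8 * CF * R ^ 4) * Cu
        + (CΦ * R ^ 2 + CF' * R ^ 2 + C8 * CF' * R ^ 6) * e * N := by
      have h' : e ^ 2 * Φ ≤ CΦ * R ^ 2 * e * N := by linarith [heΦ]
      have hid' : (1 + CF + C8 * CF * R ^ 4) * Cu + (CΦ * R ^ 2 + CF' * R ^ 2 + C8 * CF' * R ^ 6) * e * N
          = Cu + CΦ * R ^ 2 * e * N + (C8 * CF * R ^ 4 * Cu + C8 * CF' * R ^ 6 * e * N)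
            + (CF * Cu + CF' * R ^ 2 * e * N) := by ring
      rw [hid']
      linarith [hK, hρ', h']
    calc Hρ ≤ CW * (Cu + e ^ 2 * Φ + K + R⁻¹ ^ 2 * ρ) := h10
      _ ≤ CW * ((1 + CF + C8 * CF * R ^ 4) * Cu + (CΦ * R ^ 2 + CF' * R ^ 2 + C8 * CF' * R ^ 6) * e * N) :=
          mul_le_mul_of_nonneg_left hsum hCW
      _ = _ := by ring
  -- (7) HM
  have hHM : HM ≤ CH * (1 + CΦ) * R⁻¹ ^ 2 * N := by
    have hΦ'' : R⁻¹ ^ 4 * Φ ≤ R⁻¹ ^ 2 * (CΦ * N) := by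
      calc R⁻¹ ^ 4 * Φ ≤ R⁻¹ ^ 4 * (CΦ * R ^ 2 * N) := mul_le_mul_of_nonneg_left hΦ (by positivity)
        _ = R⁻¹ ^ 2 * (CΦ * N) := hR4Φ
    have hG' : R⁻¹ ^ 2 * Gφ ≤ R⁻¹ ^ 2 * N := mul_le_mul_of_nonneg_left h1 (by positivity)
    calc HM ≤ CH * (R⁻¹ ^ 2 * Gφ + R⁻¹ ^ 4 * Φ) := h11
      _ ≤ CH * (R⁻¹ ^ 2 * N + R⁻¹ ^ 2 * (CΦ * N)) := by apply mul_le_mul_of_nonneg_left _ hCH; linarith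
      _ = CH * (1 + CΦ) * R⁻¹ ^ 2 * N := by ring
  exact ⟨hΦ, hρ, hK, hL, hM, hHρ, hHM⟩

/-! ## §2 The currency table: chart letters `(R_f, η, ℓ, α, d)` → budget letters `(R₀, e)` -/

/-- ★ **(h2) CURRENCY — POINCARÉ**: `Φ ≤ 16R_f(2R_f+1)η²·Gφ`, `R_f ≤ 4R₀ℓ`, `1 ≤ R₀ℓ`, `ηℓ = 1` ⟹ `Φ ≤ 576·R₀²·Gφ`. [folklore] -/
theorem currency_h2 {ℓ η R₀ Rf Gφ Φ : ℝ} (hℓη : η * ℓ = 1) (hRf0 : 0 ≤ Rf) (hRf : Rf ≤ 4 * R₀ * ℓ) (hone : 1 ≤ R₀ * ℓ) (hG : 0 ≤ Gφ)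
    (h2 : Φ ≤ 16 * Rf * (2 * Rf + 1) * η ^ 2 * Gφ) : Φ ≤ 576 * R₀ ^ 2 * Gφ := by
  have h4R : 0 ≤ 4 * R₀ * ℓ := hRf0.trans hRf
  have hA : Rf * (2 * Rf + 1) ≤ (4 * R₀ * ℓ) * (9 * (R₀ * ℓ)) :=
    mul_le_mul hRf (by linarith) (by linarith) h4R
  calc Φ ≤ 16 * Rf * (2 * Rf + 1) * η ^ 2 * Gφ := h2
    _ = 16 * (Rf * (2 * Rf + 1)) * (η ^ 2 * Gφ) := by ring
    _ ≤ 16 * ((4 * R₀ * ℓ) * (9 * (R₀ * ℓ))) * (η ^ 2 * Gφ) :=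
        mul_le_mul_of_nonneg_right (mul_le_mul_of_nonneg_left hA (by norm_num)) (mul_nonneg (sq_nonneg η) hG)
    _ = 576 * R₀ ^ 2 * Gφ * (η * ℓ) ^ 2 := by ring
    _ = 576 * R₀ ^ 2 * Gφ := by rw [hℓη, one_pow, mul_one]

/-- ★ **(h3) CURRENCY — SOURCE**: the common bound `K := 16d³·2·R_f²·α²·η⁻²·ρ` with `d = 3`, `α ≤ A·e·η²`, `R_f ≤ 4R₀ℓ`, `ηℓ = 1` is
`≤ 13824·A²·R₀²·e²·ρ`. [folklore] -/
theorem currency_h3 {ℓ η R₀ Rf e α A ρ : ℝ} {d : ℕ} (hd : d = 3) (hℓη : η * ℓ = 1) (hη : 0 < η) (hRf0 : 0 ≤ Rf) (hRf : Rf ≤ 4 * R₀ * ℓ)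
    (hα : 0 ≤ α) (hαe : α ≤ A * e * η ^ 2) (hρ : 0 ≤ ρ) :
    16 * (d : ℝ) ^ 3 * 2 * Rf ^ 2 * α ^ 2 * (η⁻¹) ^ 2 * ρ ≤ 13824 * A ^ 2 * R₀ ^ 2 * e ^ 2 * ρ := by
  subst hd
  have hα2 : α ^ 2 ≤ (A * e * η ^ 2) ^ 2 := pow_le_pow_left₀ hα hαe 2
  have hRf2 : Rf ^ 2 ≤ (4 * R₀ * ℓ) ^ 2 := pow_le_pow_left₀ hRf0 hRf 2
  have hηi : η * η⁻¹ = 1 := mul_inv_cancel₀ hη.ne'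
  have hB : Rf ^ 2 * α ^ 2 ≤ (4 * R₀ * ℓ) ^ 2 * (A * e * η ^ 2) ^ 2 := mul_le_mul hRf2 hα2 (sq_nonneg _) (sq_nonneg _)
  calc 16 * ((3 : ℕ) : ℝ) ^ 3 * 2 * Rf ^ 2 * α ^ 2 * (η⁻¹) ^ 2 * ρ
      = 864 * (Rf ^ 2 * α ^ 2) * ((η⁻¹) ^ 2 * ρ) := by push_cast; ring
    _ ≤ 864 * ((4 * R₀ * ℓ) ^ 2 * (A * e * η ^ 2) ^ 2) * ((η⁻¹) ^ 2 * ρ) :=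
        mul_le_mul_of_nonneg_right (mul_le_mul_of_nonneg_left hB (by norm_num)) (mul_nonneg (sq_nonneg _) hρ)
    _ = 13824 * A ^ 2 * R₀ ^ 2 * e ^ 2 * ρ * ((η * ℓ) ^ 2 * (η * η⁻¹) ^ 2) := by ring
    _ = 13824 * A ^ 2 * R₀ ^ 2 * e ^ 2 * ρ := by rw [hℓη, hηi, one_pow, mul_one, mul_one]

/-- ★ **(h4) CURRENCY — RESIDUAL**: `ρ ≤ 24(2R_f+1)²·C_raw + 768d²R_f(2R_f+1)³α²·N` (the member residual row) with the raw curl functional read in the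
budget's curl letter `C_raw ≤ Cc·ℓ⁻²·Cu`, `d = 3`, `α ≤ A·e·η²`, `R_f ≤ 4R₀ℓ`, `1 ≤ R₀ℓ`, `ηℓ = 1` ⟹ `ρ ≤ 1944·Cc·R₀²·Cu + 20155392·A²·R₀⁴·e²·N`. [folklore] -/
theorem currency_h4 {ℓ η R₀ Rf e α A ρ Craw Cc Cu N : ℝ} {d : ℕ} (hd : d = 3) (hℓη : η * ℓ = 1) (hℓ : 0 < ℓ) (hRf0 : 0 ≤ Rf)
    (hRf : Rf ≤ 4 * R₀ * ℓ) (hone : 1 ≤ R₀ * ℓ) (hα : 0 ≤ α) (hαe : α ≤ A * e * η ^ 2) (hN : 0 ≤ N) (hCc : 0 ≤ Cc) (hCu : 0 ≤ Cu)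
    (hC : Craw ≤ Cc * (ℓ⁻¹) ^ 2 * Cu)
    (h4 : ρ ≤ 24 * (2 * Rf + 1) ^ 2 * Craw + 768 * (d : ℝ) ^ 2 * Rf * (2 * Rf + 1) ^ 3 * α ^ 2 * N) :
    ρ ≤ 1944 * Cc * R₀ ^ 2 * Cu + 20155392 * A ^ 2 * R₀ ^ 4 * e ^ 2 * N := by
  subst hd
  have h4R : 0 ≤ 4 * R₀ * ℓ := hRf0.trans hRf
  have hRℓ : 0 ≤ R₀ * ℓ := zero_le_one.trans hone
  have hℓi : ℓ * ℓ⁻¹ = 1 := mul_inv_cancel₀ hℓ.ne'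
  have h2R1 : 2 * Rf + 1 ≤ 9 * (R₀ * ℓ) := by linarith
  have h2R0 : 0 ≤ 2 * Rf + 1 := by linarith
  have hP2 : (2 * Rf + 1) ^ 2 ≤ (9 * (R₀ * ℓ)) ^ 2 := pow_le_pow_left₀ h2R0 h2R1 2
  have hP3 : (2 * Rf + 1) ^ 3 ≤ (9 * (R₀ * ℓ)) ^ 3 := pow_le_pow_left₀ h2R0 h2R1 3
  have hα2 : α ^ 2 ≤ (A * e * η ^ 2) ^ 2 := pow_le_pow_left₀ hα hαe 2
  -- first term
  have hT1 : 24 * (2 * Rf + 1) ^ 2 * Craw ≤ 1944 * Cc * R₀ ^ 2 * Cu := by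
    have hCraw : Craw ≤ Cc * (ℓ⁻¹) ^ 2 * Cu := hC
    have h0 : 0 ≤ Cc * (ℓ⁻¹) ^ 2 * Cu := by positivity
    calc 24 * (2 * Rf + 1) ^ 2 * Craw ≤ 24 * (2 * Rf + 1) ^ 2 * (Cc * (ℓ⁻¹) ^ 2 * Cu) :=
          mul_le_mul_of_nonneg_left hCraw (by positivity)
      _ ≤ 24 * (9 * (R₀ * ℓ)) ^ 2 * (Cc * (ℓ⁻¹) ^ 2 * Cu) :=
          mul_le_mul_of_nonneg_right (mul_le_mul_of_nonneg_left hP2 (by norm_num)) h0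
      _ = 1944 * Cc * R₀ ^ 2 * Cu * (ℓ * ℓ⁻¹) ^ 2 := by ring
      _ = 1944 * Cc * R₀ ^ 2 * Cu := by rw [hℓi, one_pow, mul_one]
  -- second term
  have hT2 : 768 * ((3 : ℕ) : ℝ) ^ 2 * Rf * (2 * Rf + 1) ^ 3 * α ^ 2 * N ≤ 20155392 * A ^ 2 * R₀ ^ 4 * e ^ 2 * N := by
    have hB : Rf * (2 * Rf + 1) ^ 3 ≤ (4 * R₀ * ℓ) * (9 * (R₀ * ℓ)) ^ 3 :=
      mul_le_mul hRf hP3 (pow_nonneg h2R0 3) h4R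
    have hB0 : 0 ≤ (4 * R₀ * ℓ) * (9 * (R₀ * ℓ)) ^ 3 := by positivity
    have hBB : Rf * (2 * Rf + 1) ^ 3 * α ^ 2 ≤ (4 * R₀ * ℓ) * (9 * (R₀ * ℓ)) ^ 3 * (A * e * η ^ 2) ^ 2 :=
      mul_le_mul hB hα2 (sq_nonneg _) hB0
    calc 768 * ((3 : ℕ) : ℝ) ^ 2 * Rf * (2 * Rf + 1) ^ 3 * α ^ 2 * N
        = 6912 * (Rf * (2 * Rf + 1) ^ 3 * α ^ 2) * N := by push_cast; ring
      _ ≤ 6912 * ((4 * R₀ * ℓ) * (9 * (R₀ * ℓ)) ^ 3 * (A * e * η ^ 2) ^ 2) * N :=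
          mul_le_mul_of_nonneg_right (mul_le_mul_of_nonneg_left hBB (by norm_num)) hN
      _ = 20155392 * A ^ 2 * R₀ ^ 4 * e ^ 2 * N * (η * ℓ) ^ 4 := by ring
      _ = 20155392 * A ^ 2 * R₀ ^ 4 * e ^ 2 * N := by rw [hℓη, one_pow, mul_one]
  linarith

/-- ★ **(h10) CURRENCY — INTERIOR `H¹` ROW**: `Hρ ≤ 24·Cu + 48d²ℓ⁴α²·Φ + 4·K_l + 16dℓ²δ²·ρ` with `K_l ≤ K`, `d = 3`, `α ≤ A·e·η²`, `ηℓ = 1`,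
`δ ≤ Cδ·(R₀ℓ)⁻¹` ⟹ `Hρ ≤ (24 + 432A² + 48Cδ²)·(Cu + e²Φ + K + R₀⁻²ρ)` (the shape of ✓`patch_budget`'s `h10`). [folklore] -/
theorem currency_h10 {ℓ η R₀ e α A δ Cδ Φ ρ Cu Kl K Hρ : ℝ} {d : ℕ} (hd : d = 3) (hℓη : η * ℓ = 1) (hℓ : 0 < ℓ) (hR₀ : 0 < R₀)
    (hα : 0 ≤ α) (hαe : α ≤ A * e * η ^ 2) (hδ : 0 ≤ δ) (hδC : δ ≤ Cδ * (R₀ * ℓ)⁻¹) (hΦ : 0 ≤ Φ) (hρ : 0 ≤ ρ) (hCu : 0 ≤ Cu)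
    (hK0 : 0 ≤ K) (hKl : Kl ≤ K)
    (h10 : Hρ ≤ 24 * Cu + 48 * (d : ℝ) ^ 2 * ℓ ^ 4 * α ^ 2 * Φ + 4 * Kl + 16 * (d : ℝ) * ℓ ^ 2 * δ ^ 2 * ρ) :
    Hρ ≤ (24 + 432 * A ^ 2 + 48 * Cδ ^ 2) * (Cu + e ^ 2 * Φ + K + R₀⁻¹ ^ 2 * ρ) := by
  subst hd
  have hℓi : ℓ * ℓ⁻¹ = 1 := mul_inv_cancel₀ hℓ.ne'
  have hα2 : α ^ 2 ≤ (A * e * η ^ 2) ^ 2 := pow_le_pow_left₀ hα hαe 2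
  have hδ2 : δ ^ 2 ≤ (Cδ * (R₀ * ℓ)⁻¹) ^ 2 := pow_le_pow_left₀ hδ hδC 2
  have hT2 : 48 * ((3 : ℕ) : ℝ) ^ 2 * ℓ ^ 4 * α ^ 2 * Φ ≤ 432 * A ^ 2 * (e ^ 2 * Φ) := by
    calc 48 * ((3 : ℕ) : ℝ) ^ 2 * ℓ ^ 4 * α ^ 2 * Φ = 432 * ℓ ^ 4 * (α ^ 2 * Φ) := by push_cast; ring
      _ ≤ 432 * ℓ ^ 4 * ((A * e * η ^ 2) ^ 2 * Φ) :=
          mul_le_mul_of_nonneg_left (mul_le_mul_of_nonneg_right hα2 hΦ) (by positivity)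
      _ = 432 * A ^ 2 * (e ^ 2 * Φ) * (η * ℓ) ^ 4 := by ring
      _ = 432 * A ^ 2 * (e ^ 2 * Φ) := by rw [hℓη, one_pow, mul_one]
  have hT4 : 16 * ((3 : ℕ) : ℝ) * ℓ ^ 2 * δ ^ 2 * ρ ≤ 48 * Cδ ^ 2 * (R₀⁻¹ ^ 2 * ρ) := by
    calc 16 * ((3 : ℕ) : ℝ) * ℓ ^ 2 * δ ^ 2 * ρ = 48 * ℓ ^ 2 * (δ ^ 2 * ρ) := by push_cast; ring
      _ ≤ 48 * ℓ ^ 2 * ((Cδ * (R₀ * ℓ)⁻¹) ^ 2 * ρ) :=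
          mul_le_mul_of_nonneg_left (mul_le_mul_of_nonneg_right hδ2 hρ) (by positivity)
      _ = 48 * Cδ ^ 2 * (R₀⁻¹ ^ 2 * ρ) * (ℓ * ℓ⁻¹) ^ 2 := by rw [mul_inv]; ring
      _ = 48 * Cδ ^ 2 * (R₀⁻¹ ^ 2 * ρ) := by rw [hℓi, one_pow, mul_one]
  have hT3 : 4 * Kl ≤ 4 * K := by linarith
  have hA2 : 0 ≤ A ^ 2 := sq_nonneg A
  have hC2 : 0 ≤ Cδ ^ 2 := sq_nonneg Cδ
  have he2Φ : 0 ≤ e ^ 2 * Φ := mul_nonneg (sq_nonneg e) hΦ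
  have hRρ : 0 ≤ R₀⁻¹ ^ 2 * ρ := mul_nonneg (sq_nonneg _) hρ
  have hstep : Hρ ≤ 24 * Cu + 432 * A ^ 2 * (e ^ 2 * Φ) + 4 * K + 48 * Cδ ^ 2 * (R₀⁻¹ ^ 2 * ρ) :=
    h10.trans (add_le_add (add_le_add (add_le_add le_rfl hT2) hT3) hT4)
  have hid : (24 + 432 * A ^ 2 + 48 * Cδ ^ 2) * (Cu + e ^ 2 * Φ + K + R₀⁻¹ ^ 2 * ρ)
      = (24 * Cu + 432 * A ^ 2 * (e ^ 2 * Φ) + 4 * K + 48 * Cδ ^ 2 * (R₀⁻¹ ^ 2 * ρ))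
        + ((432 * A ^ 2 + 48 * Cδ ^ 2) * Cu + (24 + 48 * Cδ ^ 2) * (e ^ 2 * Φ) + (20 + 432 * A ^ 2 + 48 * Cδ ^ 2) * K
            + (24 + 432 * A ^ 2) * (R₀⁻¹ ^ 2 * ρ)) := by ring
  rw [hid]
  have hextra : 0 ≤ (432 * A ^ 2 + 48 * Cδ ^ 2) * Cu + (24 + 48 * Cδ ^ 2) * (e ^ 2 * Φ) + (20 + 432 * A ^ 2 + 48 * Cδ ^ 2) * K
      + (24 + 432 * A ^ 2) * (R₀⁻¹ ^ 2 * ρ) := by positivity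
  linarith

/-- ★ **(hw) CURRENCY — THE (B8) PLAQUETTE WINDOW**: `64d³·2·R_f³(2R_f+1)·α² ≤ 1` follows from `1990656·A²·R₀⁴·e² ≤ 1` (`d = 3`, `α ≤ A·e·η²`,
`R_f ≤ 4R₀ℓ`, `1 ≤ R₀ℓ`, `ηℓ = 1`) — a `K`-uniform window `e ≤ e_P(s)`. [folklore] -/
theorem currency_window {ℓ η R₀ Rf e α A : ℝ} {d : ℕ} (hd : d = 3) (hℓη : η * ℓ = 1) (hRf0 : 0 ≤ Rf) (hRf : Rf ≤ 4 * R₀ * ℓ)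
    (hone : 1 ≤ R₀ * ℓ) (hα : 0 ≤ α) (hαe : α ≤ A * e * η ^ 2) (hw : 1990656 * A ^ 2 * R₀ ^ 4 * e ^ 2 ≤ 1) :
    64 * (d : ℝ) ^ 3 * 2 * Rf ^ 3 * (2 * Rf + 1) * α ^ 2 ≤ 1 := by
  subst hd
  have h4R : 0 ≤ 4 * R₀ * ℓ := hRf0.trans hRf
  have h2R1 : 2 * Rf + 1 ≤ 9 * (R₀ * ℓ) := by linarith
  have h2R0 : 0 ≤ 2 * Rf + 1 := by linarith
  have hR3 : Rf ^ 3 ≤ (4 * R₀ * ℓ) ^ 3 := pow_le_pow_left₀ hRf0 hRf 3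
  have hα2 : α ^ 2 ≤ (A * e * η ^ 2) ^ 2 := pow_le_pow_left₀ hα hαe 2
  have hB : Rf ^ 3 * (2 * Rf + 1) ≤ (4 * R₀ * ℓ) ^ 3 * (9 * (R₀ * ℓ)) := mul_le_mul hR3 h2R1 h2R0 (pow_nonneg h4R 3)
  have hB0 : 0 ≤ (4 * R₀ * ℓ) ^ 3 * (9 * (R₀ * ℓ)) := by positivity
  have hBB : Rf ^ 3 * (2 * Rf + 1) * α ^ 2 ≤ (4 * R₀ * ℓ) ^ 3 * (9 * (R₀ * ℓ)) * (A * e * η ^ 2) ^ 2 :=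
    mul_le_mul hB hα2 (sq_nonneg _) hB0
  calc 64 * ((3 : ℕ) : ℝ) ^ 3 * 2 * Rf ^ 3 * (2 * Rf + 1) * α ^ 2 = 3456 * (Rf ^ 3 * (2 * Rf + 1) * α ^ 2) := by push_cast; ring
    _ ≤ 3456 * ((4 * R₀ * ℓ) ^ 3 * (9 * (R₀ * ℓ)) * (A * e * η ^ 2) ^ 2) := mul_le_mul_of_nonneg_left hBB (by norm_num)
    _ = 1990656 * A ^ 2 * R₀ ^ 4 * e ^ 2 * (η * ℓ) ^ 4 := by ring
    _ = 1990656 * A ^ 2 * R₀ ^ 4 * e ^ 2 := by rw [hℓη, one_pow, mul_one]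
    _ ≤ 1 := hw

/-- ★ **(hw4) CURRENCY — THE RESIDUAL ROW'S WINDOW**: `832d³(2R_f+1)²R_f²·α² ≤ 1` follows from `29113344·A²·R₀⁴·e² ≤ 1`. [folklore] -/
theorem currency_window4 {ℓ η R₀ Rf e α A : ℝ} {d : ℕ} (hd : d = 3) (hℓη : η * ℓ = 1) (hRf0 : 0 ≤ Rf) (hRf : Rf ≤ 4 * R₀ * ℓ)
    (hone : 1 ≤ R₀ * ℓ) (hα : 0 ≤ α) (hαe : α ≤ A * e * η ^ 2) (hw : 29113344 * A ^ 2 * R₀ ^ 4 * e ^ 2 ≤ 1) :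
    832 * (d : ℝ) ^ 3 * (2 * Rf + 1) ^ 2 * Rf ^ 2 * α ^ 2 ≤ 1 := by
  subst hd
  have h4R : 0 ≤ 4 * R₀ * ℓ := hRf0.trans hRf
  have h2R1 : 2 * Rf + 1 ≤ 9 * (R₀ * ℓ) := by linarith
  have h2R0 : 0 ≤ 2 * Rf + 1 := by linarith
  have hR2 : Rf ^ 2 ≤ (4 * R₀ * ℓ) ^ 2 := pow_le_pow_left₀ hRf0 hRf 2
  have hP2 : (2 * Rf + 1) ^ 2 ≤ (9 * (R₀ * ℓ)) ^ 2 := pow_le_pow_left₀ h2R0 h2R1 2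
  have hα2 : α ^ 2 ≤ (A * e * η ^ 2) ^ 2 := pow_le_pow_left₀ hα hαe 2
  have hB : (2 * Rf + 1) ^ 2 * Rf ^ 2 ≤ (9 * (R₀ * ℓ)) ^ 2 * (4 * R₀ * ℓ) ^ 2 := mul_le_mul hP2 hR2 (sq_nonneg _) (by positivity)
  have hB0 : 0 ≤ (9 * (R₀ * ℓ)) ^ 2 * (4 * R₀ * ℓ) ^ 2 := by positivity
  have hBB : (2 * Rf + 1) ^ 2 * Rf ^ 2 * α ^ 2 ≤ (9 * (R₀ * ℓ)) ^ 2 * (4 * R₀ * ℓ) ^ 2 * (A * e * η ^ 2) ^ 2 :=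
    mul_le_mul hB hα2 (sq_nonneg _) hB0
  calc 832 * ((3 : ℕ) : ℝ) ^ 3 * (2 * Rf + 1) ^ 2 * Rf ^ 2 * α ^ 2 = 22464 * ((2 * Rf + 1) ^ 2 * Rf ^ 2 * α ^ 2) := by push_cast; ring
    _ ≤ 22464 * ((9 * (R₀ * ℓ)) ^ 2 * (4 * R₀ * ℓ) ^ 2 * (A * e * η ^ 2) ^ 2) := mul_le_mul_of_nonneg_left hBB (by norm_num)
    _ = 29113344 * A ^ 2 * R₀ ^ 4 * e ^ 2 * (η * ℓ) ^ 4 := by ring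
    _ = 29113344 * A ^ 2 * R₀ ^ 4 * e ^ 2 := by rw [hℓη, one_pow, mul_one]
    _ ≤ 1 := hw

end Summit.QuantumFields.YangMills.Theorems.Prop7DivRecoveryAssemblyBudgetW4

end
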